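import Literature.NumberTheory.Rogawski1990.UnitOrbitalIntegralInertValueThetaZeroCorner   -- ★ `UnitaryGroup.natCard_fixedPoints_unitaryInt_corner_eq_phiZero` (θ̄ = 0, frame CONSTRUCTED, no case-(e) letter)
import Literature.NumberTheory.Rogawski1990.UnitOrbitalIntegralInertValueThetaOneCorner    -- ★ `UnitaryGroup.natCard_fixedPoints_unitaryInt_corner_eq_phiOne` (θ̄ = 1, frame CONSTRUCTED, `N₊` eliminated)
import Summits.HodgeConjecture.HodgeConjecture.Theorems.R90S6TreeFixDataFlickerU3Hyp      -- ★ FILE 0 (this seat): (H.0) coset-currency bridge, (H.3) `flickerFix_thetaZero_caseTag`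
import HarnessLib

/-!
# R90 · S6 «Ch. 14.1–14.5 stable trace formula» — card GF1 FILE 2b, FILE 0c: THE HYPERSPECIAL COLUMN IN THE LEAN «CORNER» FRAME —
# `V₀(t_1(a,b,c)) = φ₀(q; N₁, N₂, N)` and `V₀(t_ϖ(a,b,c)) = φ₁(q; N₁, N)` from `LocalConjDatum` data alone, NO case-(e) letter (`Theorems/R90S6TreeFixDataFlickerU3HypCorner.lean`)

Cell `hodgecm-mathlib`, crux H413 (`stmt-HodgeConjecture-24833`), route of record `HCCMUnconditional`; programme R90-TF (brief `director/R90-BRIEF.v2.md`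
1f40d54518340a35), section S6 (base `R90-C14`, dealer R90-C14-plan (g2)), seat R90-C14-p10 (g2); card GF1 FILE 2b (cut K2Liu-p14 (g5) 02:49:55Z), sibling of ★ FILE 0
`R90S6TreeFixDataFlickerU3Hyp` (p864908 ∕ ED. 2 p865112).  Lane `--kind proof --supports stmt-HodgeConjecture-24833 --as helper`; THEOREMS ONLY (no definition, no instance,
no notation, no named fact, no kit, no `sorry`); imports = ★ Literature `UnitOrbitalIntegralInertValueThetaZeroCorner` + `…ThetaOneCorner` + ★ FILE 0 + HarnessLib.

WHY A SIBLING.  ★ FILE 0 re-read the `_of_bridge` editions of the Flicker a₀ closed forms, which carry the heavy (F3c-γ) frame (`c`, `u_m`, `r_i`, the lattice bridge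
`(R, ι, σR, dR, ϖR)`, `1 < q`) and, for θ̄ = 0, the printed case-(e) count `hce` as a hypothesis.  The tree ALSO holds the ★ «CORNER» editions
`UnitaryGroup.natCard_fixedPoints_unitaryInt_corner_eq_phiZero` [`UnitOrbitalIntegralInertValueThetaZeroCorner` :46] and `…_corner_eq_phiOne` [`…ThetaOneCorner` :79], in which
that frame is CONSTRUCTED from the local datum and — θ̄ = 0 — the case-(e) count is DISCHARGED (★ `UnitOrbitalIntegralInertValueThetaZeroComplete`), θ̄ = 1 — the exponent
`N₊` is eliminated.  These are the editions p05's R2M FILE 2 (`R90S6TorusFixedSpecialCountTwoCongruentFlicker`) uses for the SPECIAL column; this file puts the HYPERSPECIAL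
column in the SAME lean frame, so that the (G1) discharge (R90-C14-p02) and 2b-Congruent ∕ -Unipotent compose `V₀` and `V₁` under ONE binder set:
`(hd : LocalConjDatum σ ϖ)`, complete DVR integers with finite residue field, `hσO` (`σ` preserves `𝒪`), `y` with `y σy = −2`, `#𝓀 = q²` (`Nat.card`), an integer `a₀` with
`σa₀ − a₀` a unit, the literal, its depth letters — nothing else:
* §1 (H.1c) **`flickerFix_natCard_fixedBy_hyp_tpi_corner`** — `V₀(t_ϖ(a,b,c)) = phiOne q N₁ N` in `ℚ` (`N = ord(a − c)`, `N₁ = ord(a − b)`), ALL regimes, unconditional;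
* §1 (H.2c) **`flickerFix_natCard_fixedBy_hyp_tOne_corner`** — `V₀(t_1(a,b,c)) = phiZero q N₁ N₂ N` in `ℚ`, ALL regimes, UNCONDITIONAL (no `hce`; the case tag of the ★ head
  discharged by ★ FILE 0 (H.3) through `hd.v2`, `hd.vϖ`).
Both in GF1's coset currency `Nat.card (fixedBy (U ⧸ (glInt 3 K).subgroupOf U) γ)` (★ FILE 0 (H.0)), with `hfin` from GF1's `[Fintype (fixedBy …)]`; `t₃ = t_ϖ(a,c,b)`,
`t₄ = t_ϖ(b,a,c)` by permuting the letters.  R-III sanity: `phiOne q 0 0 = 0`, `phiZero q 0 0 0 = 1`.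
HONEST LABEL: re-currencying of ★ closed forms, count-neutral until (E1) consumes it; proves no printed global statement, discharges no citation; HC_CM is proved only modulo
the 7 printed citations (2 remaining named inputs: hLiu418 = stmt-HodgeConjecture-24832, h413 = stmt-HodgeConjecture-24833) until rung 0 closes.  REL ≠ ★ ≠ BUILT.

## References
* [Flicker1998UnitaryFL] Y. Z. Flicker, *Elementary proof of the fundamental lemma for a unitary group*, Canad. J. Math. 50 (1998): Prop. 5 p. 82, Prop. 6 p. 83, Cor. 9
  p. 85, Prop. 11 p. 87 (`θ̄ = 1`), Props. 12–13 pp. 89–94, Prop. 14 p. 94 (`θ̄ = 0`).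
* [Rogawski1990] J. D. Rogawski, *Automorphic Representations of Unitary Groups in Three Variables*, Ann. of Math. Stud. 123 (1990): §4.9 Prop. 4.9.1 (b) pp. 54–55.
* [Kottwitz1986BaseChangeUnits] R. E. Kottwitz, *Base change for unit elements of Hecke algebras*, Compositio Math. 60 (1986): §3 (fixed vertices ↔ fixed cosets).
-/

set_option autoImplicit false
-- the mandated namespace repeats the single-problem summit's segment (`HodgeConjecture.HodgeConjecture`)
set_option linter.dupNamespace false

noncomputable section

open MulAction IsLocalRing
open scoped Valued WithZero Matrix MatrixGroups
open Literature.NumberTheory.Automorphic Literature.NumberTheory.Automorphic.HermitianLattice Literature.NumberTheory.Automorphic.UnitaryLatticeTree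
  Literature.NumberTheory.Automorphic.UnitaryGroup
open Literature.NumberTheory.Rogawski1990.Flicker1998 (phiZero phiOne)

namespace Summit.HodgeConjecture.HodgeConjecture.R90.S6

/-! ## §1 The hyperspecial fixed counts in the «corner» frame -/

section Corner

variable {K : Type*} [Field K] [Valued K ℤᵐ⁰] [ValuativeRel K] [(Valued.v : Valuation K ℤᵐ⁰).Compatible]
  [IsDiscreteValuationRing (Valued.integer K)] [Finite (ResidueField (Valued.integer K))] [IsAdicComplete (maximalIdeal (Valued.integer K)) (Valued.integer K)]
  {σ : K →+* K} {ϖ : K}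

omit [IsDiscreteValuationRing (Valued.integer K)] [Finite (ResidueField (Valued.integer K))] [IsAdicComplete (maximalIdeal (Valued.integer K)) (Valued.integer K)] in
/-- The two coset currencies, as subgroups: `(glInt 3 K).subgroupOf U = unitaryInt σ J₀` (entrywise; ★ `mem_glInt_iff_isIntMatrix`, ★ `mem_unitaryInt_iff`).
[cite: Kottwitz1986BaseChangeUnits, §3] -/
private theorem flickerFix_subgroupOf_glInt_eq_unitaryInt_three :
    (glInt 3 K).subgroupOf (unitaryGroupOfForm σ ((StdForm.antidiagonal 3).over K)) = unitaryInt σ ((StdForm.antidiagonal 3).over K) := by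
  ext g
  rw [Subgroup.mem_subgroupOf, mem_glInt_iff_isIntMatrix, mem_unitaryInt_iff]
  rfl

set_option synthInstance.maxHeartbeats 200000 in
-- as in the ★ corner head: the `H`-action on `H ⧸ (K^{u_m} ∩ H)` is found through the large subgroup terms of the `U(2,1)` frame
/-- **(H.1c) `V₀(t_ϖ(a,b,c)) = φ₁(q; N₁, N)` IN THE CORNER FRAME, ALL REGIMES** — the hyperspecial fixed-coset count of Flicker's `θ̄ = 1` literal
`t_ϖ(a,b,c) = !![e(a+c), 0, −e(a−c)ϖ; 0, b, 0; −e(a−c)ϖ⁻¹, 0, e(a+c)]` ((E1) sheet's `hγ₂` bytes; `t₃`, `t₄` by permuting the letters) in GF1's currency: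
`#Fix_γ(U ⧸ (GL₃(𝒪) ⊓ U)) = phiOne q N₁ N` in `ℚ`, `|a − c| = |ϖ^N|`, `|a − b| = |ϖ^{N₁}|`, `|c − b| = |ϖ^{N₂}|` — ★ `UnitaryGroup.natCard_fixedPoints_unitaryInt_corner_eq_phiOne`
(frame constructed from the datum; `N₊` eliminated) read through ★ FILE 0 (H.0), `hfin` from GF1's `Fintype` instance.  Frame = `LocalConjDatum` + complete DVR integers with
finite residue field + `hσO`, `y σy = −2`, `#𝓀 = q²`, `a₀` (`σa₀ − a₀` a unit) — the frame of p05's R2M FILE 2 special column.  R-III sanity: `phiOne q 0 0 = 0`.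
[cite: Flicker1998UnitaryFL, Prop. 11 p. 87; Props. 12–13 pp. 89–94; Prop. 6 p. 83] [cite: Rogawski1990, §4.9 Prop. 4.9.1 (b) p. 55] -/
theorem flickerFix_natCard_fixedBy_hyp_tpi_corner (hd : LocalConjDatum σ ϖ)
    (hσO : ∀ y : Valued.integer K, (σ.comp (Valued.integer K).subtype) y ∈ Valued.integer K) {y : K} (hy : y * σ y = -2)
    {q : ℕ} (hq : Nat.card (ResidueField (Valued.integer K)) = q ^ 2)
    {a₀ : Valued.integer K} (ha₀ : IsUnit (((σ.comp (Valued.integer K).subtype).codRestrict (Valued.integer K) hσO) a₀ - a₀))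
    {e a b cc : K} (h2e : 2 * e = 1) (ha : σ a * a = 1) (hb : σ b * b = 1) (hcc : σ cc * cc = 1)
    (γ : ↥(unitaryGroupOfForm σ ((StdForm.antidiagonal 3).over K)))
    (hγ : ((γ : GL (Fin 3) K) : Matrix (Fin 3) (Fin 3) K) = !![e * (a + cc), 0, -(e * (a - cc) * ϖ); 0, b, 0; -(e * (a - cc) * ϖ⁻¹), 0, e * (a + cc)])
    {N N₁ N₂ : ℕ} (hN : Valued.v (a - cc) = Valued.v (ϖ ^ N)) (hN₁ : Valued.v (a - b) = Valued.v (ϖ ^ N₁)) (hN₂ : Valued.v (cc - b) = Valued.v (ϖ ^ N₂))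
    [Fintype (fixedBy (↥(unitaryGroupOfForm σ ((StdForm.antidiagonal 3).over K)) ⧸
      (glInt 3 K).subgroupOf (unitaryGroupOfForm σ ((StdForm.antidiagonal 3).over K))) γ)] :
    (Nat.card (fixedBy (↥(unitaryGroupOfForm σ ((StdForm.antidiagonal 3).over K)) ⧸
        (glInt 3 K).subgroupOf (unitaryGroupOfForm σ ((StdForm.antidiagonal 3).over K))) γ) : ℚ) = phiOne q N₁ N := by
  have hfin : (fixedBy (↥(unitaryGroupOfForm σ ((StdForm.antidiagonal 3).over K)) ⧸
      (glInt 3 K).subgroupOf (unitaryGroupOfForm σ ((StdForm.antidiagonal 3).over K))) γ).Finite := Set.toFinite _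
  rw [flickerFix_subgroupOf_glInt_eq_unitaryInt_three] at hfin ⊢
  exact natCard_fixedPoints_unitaryInt_corner_eq_phiOne σ rfl hd hσO hy hq ha₀ h2e ha hb hcc hγ hN hN₁ hN₂ hfin

set_option synthInstance.maxHeartbeats 200000 in
-- as in the ★ corner head: the `H`-action on `H ⧸ (K^{u_m} ∩ H)` is found through the large subgroup terms of the `U(2,1)` frame
/-- **(H.2c) `V₀(t_1(a,b,c)) = φ₀(q; N₁, N₂, N)` IN THE CORNER FRAME, ALL REGIMES, UNCONDITIONAL** — the hyperspecial fixed-coset count of Flicker's `θ̄ = 0` literal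
`t_1(a,b,c) = !![e(a+c), 0, −e(a−c); 0, b, 0; −e(a−c), 0, e(a+c)]` ((E1) sheet's `hγ₁` bytes) in GF1's currency: `#Fix_γ(U ⧸ (GL₃(𝒪) ⊓ U)) = phiZero q N₁ N₂ N` in `ℚ`,
`|a − b| = |ϖ^{N₁}|`, `|c − b| = |ϖ^{N₂}|`, `|a − c| = |ϖ^N|`, `|a + c − 2b| = |ϖ^{N₊}|` — ★ `UnitaryGroup.natCard_fixedPoints_unitaryInt_corner_eq_phiZero` (frame constructed,
case (e) DISCHARGED in ★ `…ThetaZeroComplete`), its case tag `h` discharged by ★ FILE 0 (H.3) (`|2| = 1`, `0 < |ϖ| < 1` from `hd`), `hfin` from GF1's instance.  This supersedes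
★ FILE 0 (H.2)∕(H.5) for consumers: NO `hce`, NO lattice bridge.  R-III sanity: `phiZero q 0 0 0 = 1`.
[cite: Flicker1998UnitaryFL, Prop. 14 p. 94; Prop. 13 pp. 91–93; Prop. 6 p. 83] [cite: Rogawski1990, §4.9 Prop. 4.9.1 (b) p. 55] -/
theorem flickerFix_natCard_fixedBy_hyp_tOne_corner (hd : LocalConjDatum σ ϖ)
    (hσO : ∀ y : Valued.integer K, (σ.comp (Valued.integer K).subtype) y ∈ Valued.integer K) {y : K} (hy : y * σ y = -2)
    {q : ℕ} (hq : Nat.card (ResidueField (Valued.integer K)) = q ^ 2)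
    {a₀ : Valued.integer K} (ha₀ : IsUnit (((σ.comp (Valued.integer K).subtype).codRestrict (Valued.integer K) hσO) a₀ - a₀))
    {e a b cc : K} (h2e : 2 * e = 1) (ha : σ a * a = 1) (hb : σ b * b = 1) (hcc : σ cc * cc = 1)
    (γ : ↥(unitaryGroupOfForm σ ((StdForm.antidiagonal 3).over K)))
    (hγ : ((γ : GL (Fin 3) K) : Matrix (Fin 3) (Fin 3) K) = !![e * (a + cc), 0, -(e * (a - cc)); 0, b, 0; -(e * (a - cc)), 0, e * (a + cc)])
    {N Np N₁ N₂ : ℕ} (hN : Valued.v (a - cc) = Valued.v (ϖ ^ N)) (hNp : Valued.v (a + cc - 2 * b) = Valued.v (ϖ ^ Np))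
    (hN₁ : Valued.v (a - b) = Valued.v (ϖ ^ N₁)) (hN₂ : Valued.v (cc - b) = Valued.v (ϖ ^ N₂))
    [Fintype (fixedBy (↥(unitaryGroupOfForm σ ((StdForm.antidiagonal 3).over K)) ⧸
      (glInt 3 K).subgroupOf (unitaryGroupOfForm σ ((StdForm.antidiagonal 3).over K))) γ)] :
    (Nat.card (fixedBy (↥(unitaryGroupOfForm σ ((StdForm.antidiagonal 3).over K)) ⧸
        (glInt 3 K).subgroupOf (unitaryGroupOfForm σ ((StdForm.antidiagonal 3).over K))) γ) : ℚ) = phiZero q N₁ N₂ N := by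
  have hfin : (fixedBy (↥(unitaryGroupOfForm σ ((StdForm.antidiagonal 3).over K)) ⧸
      (glInt 3 K).subgroupOf (unitaryGroupOfForm σ ((StdForm.antidiagonal 3).over K))) γ).Finite := Set.toFinite _
  have hϖ0 : 0 < Valued.v ϖ := by rw [hd.vϖ]; exact WithZero.exp_pos
  have hϖ1 : Valued.v ϖ < 1 := by rw [hd.vϖ, ← WithZero.exp_zero]; exact WithZero.exp_lt_exp.2 (by norm_num)
  have h := flickerFix_thetaZero_caseTag hϖ0 hϖ1 hd.v2 hN hNp hN₁ hN₂
  rw [flickerFix_subgroupOf_glInt_eq_unitaryInt_three] at hfin ⊢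
  exact natCard_fixedPoints_unitaryInt_corner_eq_phiZero σ rfl hd hσO hy hq ha₀ h2e ha hb hcc hγ hN hNp hN₁ hN₂ h hfin

end Corner

end Summit.HodgeConjecture.HodgeConjecture.R90.S6

end
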